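import Summits.CriticalPhenomena.SAWScalingLimit.Theorems.SAWDefectDecoherenceBoundaryClosureRBoundaryDataTransferArms
import Summits.CriticalPhenomena.SAWScalingLimit.Theorems.SAWDefectDecoherenceBoundaryClosureRBoundaryDataTransferDivergence
import Summits.CriticalPhenomena.SAWScalingLimit.Theorems.SAWDefectDecoherenceBoundaryClosureRBoundaryDataTransferFlat
import HarnessLib

/-!
# Boundary data transfer: assembly (stub `stub_engineBoundaryData`)

Route `SAWDefectDecoherence`, crux `BoundaryClosureR` (stmt-CriticalPhenomena-14004), line
`pick-half-plane`, skeleton r13.  `engineBoundaryData` is the registered stub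
`stub_engineBoundaryData : DevelopingMapExact → RootWedgeBound → FlatMassLaws → LocalSupBound →
EngineBoundaryData` with the line-local definitions (`DevelopingMapExact`, `RootWedgeBound`,
`FlatMassLaws`, `LocalSupBound`, `EngineBoundaryData`, `AdmissibleFamily`, `PinnedFlatRoot`,
`IsEngineLimit`, `IsWeakLimit`, `IsTest`, `NF`, `DevelopingMapsConverge`, `flatPoints`) unfolded
verbatim: every engine limit `h` (the locally uniform limit of the normalised developing maps on the
punctured closed region, holomorphic on the carrier) satisfies VERBATIM the hypotheses (I1)–(I4) of the
landed `Engine.pickEngine_stage2`, with `r₀ = r/4`.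

* `root_continuity` / `boundaryDataTransfer_rootContinuity` (registered) — (I1) continuity on the
  punctured closed half-disc;
* `flat_regularity_of_law` — (I4) at a flat point from the window-mass law of `FlatMassLaws` (a);
* `engineBoundaryData_core` — (I1)–(I4) for the data of the frame (`arms_wedge`, `divergence`,
  `flat_regularity`);
* `engineBoundaryData` — the registered statement.  (`DevelopingMapExact` is not used: its four
  clauses are theorems of the tree, invoked inside the landed lattice files.)
-/

noncomputable section

open scoped Topology
open Filter Set MeasureTheory
open Complex (I exp)
open Literature.Probability.LatticeModels Literature.Probability.RandomPlanarGeometry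
open Literature.Probability.RandomPlanarGeometry.SAW
open Summit.CriticalPhenomena.SAWScalingLimit.Theorems.PickHalfPlane.RootWedge
open Summit.CriticalPhenomena.SAWScalingLimit.Theorems.PickHalfPlane.DevelopingMaps

namespace Summit.CriticalPhenomena.SAWScalingLimit.Theorems.PickHalfPlane.BoundaryDataTransfer

/-- (I1) continuity, explicit form (for the registered closure). [folklore] -/
theorem root_continuity' {D : DobrushinDomain} {ρ r r₀ : ℝ} {x : ℂ} {h : ℂ → ℂ}
    (hflat : D.carrier ∩ Metric.ball x r = {z : ℂ | x.im < z.im} ∩ Metric.ball x r)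
    (hcont : ContinuousOn h ((D.carrier ∪ (({z : ℂ | z.im = (D.pt 1).im} ∩ Metric.ball (D.pt 1) ρ) ∪
      ({z : ℂ | z.im = x.im} ∩ Metric.ball x r))) \ {x}))
    (hr₀ : r₀ ≤ r) : ContinuousOn h (({z : ℂ | x.im ≤ z.im} ∩ Metric.ball x r₀) \ {x}) := by
  refine hcont.mono fun z hz => ?_
  obtain ⟨⟨hzim, hzb⟩, hzx⟩ := hz
  have hzb' : z ∈ Metric.ball x r := Metric.ball_subset_ball hr₀ hzb
  refine ⟨?_, hzx⟩
  rcases (show x.im ≤ z.im from hzim).lt_or_eq with hlt | heq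
  · exact Or.inl ((show z ∈ D.carrier ∩ Metric.ball x r by rw [hflat]; exact ⟨hlt, hzb'⟩).1)
  · exact Or.inr (Or.inr ⟨heq.symm, hzb'⟩)

/-- **Registered helper `boundaryDataTransfer_rootContinuity`** (crux stmt-CriticalPhenomena-14004, line
`pick-half-plane`, stub `stub_engineBoundaryData`): (I1) continuity of an engine limit on the punctured
closed half-disc at the root, ∀-closed (`root_continuity`). [folklore] -/
theorem boundaryDataTransfer_rootContinuity : ∀ (D : DobrushinDomain) (ρ r r₀ : ℝ) (x : ℂ) (h : ℂ → ℂ), D.carrier ∩ Metric.ball x r = {z : ℂ | x.im < z.im} ∩ Metric.ball x r → ContinuousOn h ((D.carrier ∪ (({z : ℂ | z.im = (D.pt 1).im} ∩ Metric.ball (D.pt 1) ρ) ∪ ({z : ℂ | z.im = x.im} ∩ Metric.ball x r))) \ {x}) → r₀ ≤ r → ContinuousOn h (({z : ℂ | x.im ≤ z.im} ∩ Metric.ball x r₀) \ {x}) :=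
  fun _ _ _ _ _ _ hflat hcont hr₀ => root_continuity' hflat hcont hr₀

section Frame

variable {D : DobrushinDomain} {ρ : ℝ} {Λ : ℝ → Finset HexVertex} {m : ℝ → ℤ} {b : ℝ → Sym2 HexVertex}
  (hAF : 0 < ρ ∧
    D.carrier ∩ Metric.ball (D.pt 1) ρ = {z : ℂ | (D.pt 1).im < z.im} ∩ Metric.ball (D.pt 1) ρ ∧
    (∀ᶠ δ : ℝ in 𝓝[>] 0, hexDomainSimplyConnected (Λ δ) ∧ b δ ∈ hexDomainBoundary (Λ δ) ∧
      (hexGraph.induce ((Λ δ : Finset HexVertex) : Set HexVertex)).Preconnected ∧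
      (∀ v ∈ Λ δ, (δ : ℂ) * hexCenter v ∈ D.carrier) ∧
      (∀ v : HexVertex, (δ : ℂ) * hexCenter v ∈ Metric.ball (D.pt 1) ρ →
        (v ∈ Λ δ ↔ m δ ≤ v.1 1))) ∧
    (∀ K : Set ℂ, IsCompact K → K ⊆ D.carrier →
      ∀ᶠ δ : ℝ in 𝓝[>] 0, ∀ v : HexVertex, (δ : ℂ) * hexCenter v ∈ K → v ∈ Λ δ) ∧
    Tendsto (fun δ : ℝ => (δ : ℂ) * hexMidpoint (b δ)) (𝓝[>] 0) (𝓝 (D.pt 1)))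
  {x : ℂ} {e : ℝ → Sym2 HexVertex} {r : ℝ} {mr : ℝ → ℤ}
  (hPR : 0 < r ∧ D.carrier ∩ Metric.ball x r = {z : ℂ | x.im < z.im} ∩ Metric.ball x r ∧
    (∀ᶠ δ : ℝ in 𝓝[>] 0, e δ ∈ hexDomainBoundary (Λ δ) ∧
      Nonempty (HexMidEdgeSAW (Λ δ) (e δ) (b δ)) ∧
      (∀ v : HexVertex, (δ : ℂ) * hexCenter v ∈ Metric.ball x r → (v ∈ Λ δ ↔ mr δ ≤ v.1 1))) ∧
    Tendsto (fun δ : ℝ => (δ : ℂ) * hexMidpoint (e δ)) (𝓝[>] 0) (𝓝 x))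
  (hx : x ≠ D.pt 1)
  (hSup : ∀ K : Set ℂ, IsCompact K →
    K ⊆ D.carrier ∪ (({z : ℂ | z.im = (D.pt 1).im} ∩ Metric.ball (D.pt 1) ρ) ∪
      ({z : ℂ | z.im = x.im} ∩ Metric.ball x r)) → x ∉ K →
    ∃ C : ℝ, ∀ᶠ δ : ℝ in 𝓝[>] 0, ∀ z ∈ hexDomainMidEdges (Λ δ), (δ : ℂ) * hexMidpoint z ∈ K →
      ‖hexParafermionicObservable (Λ δ) (e δ) hexCriticalFugacity (5 / 8) z‖ ≤
        C * ‖hexParafermionicObservable (Λ δ) (e δ) hexCriticalFugacity (5 / 8) (b δ)‖)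
  {ns : ℕ → ℝ} (hns : Tendsto ns atTop (𝓝[>] 0)) {h : ℂ → ℂ}
  (hcont : ContinuousOn h ((D.carrier ∪ (({z : ℂ | z.im = (D.pt 1).im} ∩ Metric.ball (D.pt 1) ρ) ∪
    ({z : ℂ | z.im = x.im} ∩ Metric.ball x r))) \ {x}))
  (hconv : ∀ K : Set ℂ, IsCompact K →
    K ⊆ (D.carrier ∪ (({z : ℂ | z.im = (D.pt 1).im} ∩ Metric.ball (D.pt 1) ρ) ∪
      ({z : ℂ | z.im = x.im} ∩ Metric.ball x r))) \ {x} →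
    ∀ ε : ℝ, 0 < ε → ∀ᶠ n : ℕ in atTop, ∀ H : Site 2 → ℂ, IsPotential (Λ (ns n)) (e (ns n)) H →
      ∀ (ub wb : HexVertex), b (ns n) = s(ub, wb) →
      ∀ sb : Site 2, sb ∈ hexFaceVertices ub → sb ∈ hexFaceVertices wb →
      ∀ s : Site 2, IsLatticeSite (Λ (ns n)) s → ((ns n : ℝ) : ℂ) * triEmbed s ∈ K →
        ‖((ns n : ℝ) : ℂ) * (H s - H sb) /
              hexParafermionicObservable (Λ (ns n)) (e (ns n)) hexCriticalFugacity (5 / 8) (b (ns n)) -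
            h (((ns n : ℝ) : ℂ) * triEmbed s)‖ < ε)

include hAF hPR hx hSup hns hcont hconv

omit hAF hx hSup hns hconv in
/-- **(I1) continuity**: an engine limit is continuous on the punctured closed half-disc of radius
`r₀ ≤ r` at the root (it lies in the punctured closed region `U`). [folklore] -/
theorem root_continuity {r₀ : ℝ} (hr₀ : r₀ ≤ r) :
    ContinuousOn h (({z : ℂ | x.im ≤ z.im} ∩ Metric.ball x r₀) \ {x}) :=
  root_continuity' hPR.2.1 hcont hr₀

/-- **(I4) at a flat point from the flat mass law.**  In the frame of a pinned flat piece (one of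
the two pieces of the closed region) and for `y ≠ x` on it: the two-sided window-mass law of
`FlatMassLaws` (a) at `y` (for every admissible window radius `ρ₀`) yields the flat regularity
data of `pickEngine_stage2` at `y` (`flat_regularity` with `ρ₁ = min(R₀ − ‖y − p₀‖, ‖y − x‖)/8`).
[cite: DuminilCopinSmirnov2012, §4 (the map H with dH = F dz)] -/
theorem flat_regularity_of_law (hhol : DifferentiableOn ℂ h D.carrier)
    {p₀ : ℂ} {R₀ : ℝ} {mf : ℝ → ℤ} {bf : ℝ → Sym2 HexVertex} (hR₀ : 0 < R₀)
    (hΩ : D.carrier ∩ Metric.ball p₀ R₀ = {z : ℂ | p₀.im < z.im} ∩ Metric.ball p₀ R₀)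
    (hpin : ∀ᶠ δ : ℝ in 𝓝[>] 0, ∀ v : HexVertex,
      (δ : ℂ) * hexCenter v ∈ Metric.ball p₀ R₀ → (v ∈ Λ δ ↔ mf δ ≤ v.1 1))
    (hbd : ∀ᶠ δ : ℝ in 𝓝[>] 0, bf δ ∈ hexDomainBoundary (Λ δ))
    (hlim : Tendsto (fun δ : ℝ => (δ : ℂ) * hexMidpoint (bf δ)) (𝓝[>] 0) (𝓝 p₀))
    (hpiece : ∀ w : ℂ, w.im = p₀.im → w ∈ Metric.ball p₀ R₀ →
      w ∈ D.carrier ∪ (({z : ℂ | z.im = (D.pt 1).im} ∩ Metric.ball (D.pt 1) ρ) ∪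
        ({z : ℂ | z.im = x.im} ∩ Metric.ball x r)))
    {y : ℂ} (hyim : y.im = p₀.im) (hyR : y ∈ Metric.ball p₀ R₀) (hyx : y ≠ x)
    (hlaw : ∀ ρ₀ : ℝ, 0 < ρ₀ → Metric.closedBall y ρ₀ ⊆ Metric.ball p₀ R₀ → x ∉ Metric.closedBall y (2 * ρ₀) →
      ∃ C : ℝ, 0 < C ∧ ∀ ρ' : ℝ, 0 < ρ' → ρ' ≤ ρ₀ → ∀ᶠ δ : ℝ in 𝓝[>] 0,
        C⁻¹ * ρ' * ‖hexParafermionicObservable (Λ δ) (e δ) hexCriticalFugacity 0 (b δ)‖ ≤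
        δ * ∑ᶠ e' ∈ {e' : Sym2 HexVertex | e' ∈ hexDomainBoundary (Λ δ) ∧
            (δ : ℂ) * hexMidpoint e' ∈ Metric.ball y ρ'},
          ‖hexParafermionicObservable (Λ δ) (e δ) hexCriticalFugacity 0 e'‖) :
    ∃ ρ' : ℝ, 0 < ρ' ∧ ∃ θ' : ℝ, ∃ p' : ℂ, ∃ c' : ℝ, 0 < c' ∧
      ContinuousOn h ({z : ℂ | y.im ≤ z.im} ∩ Metric.ball y ρ') ∧
      (∀ z ∈ Metric.ball y ρ', z.im = y.im →
        (Complex.exp (-((θ' : ℂ) * Complex.I)) * (h z - p')).im = 0) ∧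
      (∀ t : ℝ, 0 < t → t < ρ' → c' * t ≤
        |(Complex.exp (-((θ' : ℂ) * Complex.I)) * (h (y + (t : ℂ) * Complex.I) - p')).im|) := by
  rw [Metric.mem_ball, dist_eq_norm] at hyR
  have hyx' : 0 < ‖y - x‖ := norm_pos_iff.2 (sub_ne_zero.2 hyx)
  set ρ₁ : ℝ := min (R₀ - ‖y - p₀‖) ‖y - x‖ / 8 with hρ₁
  have hmin : 0 < min (R₀ - ‖y - p₀‖) ‖y - x‖ := lt_min (by linarith) hyx'
  have hρ₁0 : 0 < ρ₁ := by positivity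
  have hρ₁R : ‖y - p₀‖ + 4 * ρ₁ ≤ R₀ := by have := min_le_left (R₀ - ‖y - p₀‖) ‖y - x‖; rw [hρ₁]; linarith
  have hρ₁x : 4 * ρ₁ ≤ ‖y - x‖ := by have := min_le_right (R₀ - ‖y - p₀‖) ‖y - x‖; rw [hρ₁]; linarith
  have hsub : Metric.closedBall y ρ₁ ⊆ Metric.ball p₀ R₀ := fun w hw => by
    rw [Metric.mem_closedBall, dist_eq_norm] at hw
    rw [Metric.mem_ball, dist_eq_norm]
    calc ‖w - p₀‖ ≤ ‖w - y‖ + ‖y - p₀‖ := norm_sub_le_norm_sub_add_norm_sub _ _ _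
      _ < R₀ := by linarith
  have hxball : x ∉ Metric.closedBall y (2 * ρ₁) := fun h0 => by
    rw [Metric.mem_closedBall, dist_comm, dist_eq_norm] at h0; linarith
  obtain ⟨C, hC, hmass⟩ := hlaw ρ₁ hρ₁0 hsub hxball
  exact flat_regularity hAF hPR hx hSup hns hcont hconv hhol hR₀ hΩ hpin hbd hlim hpiece hyim hρ₁0 hρ₁R hρ₁x hC hmass

/-- **The boundary data of an engine limit (core).**  For an admissible family, a pinned flat root
`x ≠ pt 1`, the local sup law, and a limit `h` of the normalised developing maps along `ns` that is
holomorphic on the carrier: given the lattice wedge bound near the root (`RootWedgeBound`), the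
east-arm divergence (`FlatMassLaws` (b)) and the flat window-mass laws (`FlatMassLaws` (a)) at these
data, `h` satisfies (I1)–(I4) of `pickEngine_stage2` with `r₀ = r/4`.
[cite: DuminilCopinSmirnov2012, §4 (the map H with dH = F dz)] -/
theorem engineBoundaryData_core (hhol : DifferentiableOn ℂ h D.carrier)
    (hMw : ∃ Mw : ℝ, ∀ᶠ δ : ℝ in 𝓝[>] 0, ∀ H : Site 2 → ℂ, IsPotential (Λ δ) (e δ) H →
      ∀ (ub wb : HexVertex), b δ = s(ub, wb) →
      ∀ sb : Site 2, sb ∈ hexFaceVertices ub → sb ∈ hexFaceVertices wb →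
      ∀ v ∈ Λ δ, ∀ s ∈ hexFaceVertices v, (δ : ℂ) * triEmbed s ∈ Metric.closedBall x (r / 2) →
        δ * ((H s).re - (H sb).re) ≤
          Mw * ‖hexParafermionicObservable (Λ δ) (e δ) hexCriticalFugacity 0 (b δ)‖)
    (hFlat : ∀ (y : ℂ) (ρ₀ : ℝ), 0 < ρ₀ →
      (y.im = (D.pt 1).im ∧ Metric.closedBall y ρ₀ ⊆ Metric.ball (D.pt 1) ρ ∨
        y.im = x.im ∧ Metric.closedBall y ρ₀ ⊆ Metric.ball x r) →
      x ∉ Metric.closedBall y (2 * ρ₀) →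
      ∃ C : ℝ, 0 < C ∧ ∀ ρ' : ℝ, 0 < ρ' → ρ' ≤ ρ₀ → ∀ᶠ δ : ℝ in 𝓝[>] 0,
        C⁻¹ * ρ' * ‖hexParafermionicObservable (Λ δ) (e δ) hexCriticalFugacity 0 (b δ)‖ ≤
          δ * ∑ᶠ e' ∈ {e' : Sym2 HexVertex | e' ∈ hexDomainBoundary (Λ δ) ∧
            (δ : ℂ) * hexMidpoint e' ∈ Metric.ball y ρ'},
            ‖hexParafermionicObservable (Λ δ) (e δ) hexCriticalFugacity 0 e'‖ ∧
        δ * ∑ᶠ e' ∈ {e' : Sym2 HexVertex | e' ∈ hexDomainBoundary (Λ δ) ∧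
            (δ : ℂ) * hexMidpoint e' ∈ Metric.ball y ρ'},
            ‖hexParafermionicObservable (Λ δ) (e δ) hexCriticalFugacity 0 e'‖ ≤
          C * ρ' * ‖hexParafermionicObservable (Λ δ) (e δ) hexCriticalFugacity 0 (b δ)‖)
    (hArm : ∀ A : ℝ, ∃ η : ℝ, 0 < η ∧ η < r / 2 ∧ ∀ᶠ δ : ℝ in 𝓝[>] 0,
      A * ‖hexParafermionicObservable (Λ δ) (e δ) hexCriticalFugacity 0 (b δ)‖ ≤
        δ * ∑ᶠ e' ∈ {e' : Sym2 HexVertex | e' ∈ hexDomainBoundary (Λ δ) ∧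
          (δ : ℂ) * hexMidpoint e' ∈ Metric.ball x (r / 2) ∧ x.re + η < ((δ : ℂ) * hexMidpoint e').re},
          ‖hexParafermionicObservable (Λ δ) (e δ) hexCriticalFugacity 0 e'‖) :
    ∃ (r₀ : ℝ) (p ω : ℂ) (θ M : ℝ), 0 < r₀ ∧ r₀ ≤ r ∧
      ContinuousOn h (({z : ℂ | x.im ≤ z.im} ∩ Metric.ball x r₀) \ {x}) ∧
      (∀ z ∈ Metric.ball x r₀, z.im = x.im → x.re < z.re →
        ∃ s : ℝ, h z = p + Complex.exp ((θ : ℂ) * Complex.I) * s) ∧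
      (∀ z ∈ Metric.ball x r₀, z.im = x.im → z.re < x.re →
        ∃ s : ℝ, h z = p + Complex.exp (((θ - Real.pi / 4 : ℝ) : ℂ) * Complex.I) * s) ∧
      ‖ω‖ = 1 ∧ 0 < (ω * Complex.exp (-((θ : ℂ) * Complex.I))).re ∧
      (ω * Complex.exp (-((θ : ℂ) * Complex.I))).im < (ω * Complex.exp (-((θ : ℂ) * Complex.I))).re ∧
      (∀ z ∈ ({z : ℂ | x.im ≤ z.im} ∩ Metric.ball x r₀) \ {x}, -M ≤ ((starRingEnd ℂ) ω * h z).re) ∧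
      (∀ A : ℝ, ∃ᶠ z in 𝓝[D.carrier] x, A ≤ ‖h z‖) ∧
      (∀ y ∈ ({z : ℂ | z.im = (D.pt 1).im} ∩ Metric.ball (D.pt 1) ρ) ∪
          ({z : ℂ | z.im = x.im} ∩ Metric.ball x r), y ≠ x →
        ∃ ρ' : ℝ, 0 < ρ' ∧ ∃ θ' : ℝ, ∃ p' : ℂ, ∃ c' : ℝ, 0 < c' ∧
          ContinuousOn h ({z : ℂ | y.im ≤ z.im} ∩ Metric.ball y ρ') ∧
          (∀ z ∈ Metric.ball y ρ', z.im = y.im →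
            (Complex.exp (-((θ' : ℂ) * Complex.I)) * (h z - p')).im = 0) ∧
          (∀ t : ℝ, 0 < t → t < ρ' → c' * t ≤
            |(Complex.exp (-((θ' : ℂ) * Complex.I)) * (h (y + (t : ℂ) * Complex.I) - p')).im|)) := by
  have hr := hPR.1
  obtain ⟨p, ω, θ, M, heast, hwest, hωn, hω₁, hω₂, hwedge⟩ := arms_wedge hAF hPR hx hSup hns hcont hconv hMw
  refine ⟨r / 4, p, ω, θ, M, by positivity, by linarith, root_continuity hPR hcont (by linarith), heast, hwest,
    hωn, hω₁, hω₂, hwedge, divergence hAF hPR hx hSup hns hcont hconv hArm, fun y hy hyx => ?_⟩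
  have hev := hAF.2.2.1
  have hevx := hPR.2.2.1
  rcases hy with ⟨hyim, hyb⟩ | ⟨hyim, hyb⟩
  · exact flat_regularity_of_law hAF hPR hx hSup hns hcont hconv hhol hAF.1 hAF.2.1 (hev.mono fun _ h => h.2.2.2.2)
      (hev.mono fun _ h => h.2.1) hAF.2.2.2.2 (fun w hwim hwb => Or.inr (Or.inl ⟨hwim, hwb⟩)) hyim hyb hyx
      fun ρ₀ hρ₀ hsub hxball => by
        obtain ⟨C, hC, hb⟩ := hFlat y ρ₀ hρ₀ (Or.inl ⟨hyim, hsub⟩) hxball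
        exact ⟨C, hC, fun ρ' h1 h2 => (hb ρ' h1 h2).mono fun _ h => h.1⟩
  · exact flat_regularity_of_law hAF hPR hx hSup hns hcont hconv hhol hPR.1 hPR.2.1 (hevx.mono fun _ h => h.2.2)
      (hevx.mono fun _ h => h.1) hPR.2.2.2 (fun w hwim hwb => Or.inr (Or.inr ⟨hwim, hwb⟩)) hyim hyb hyx
      fun ρ₀ hρ₀ hsub hxball => by
        obtain ⟨C, hC, hb⟩ := hFlat y ρ₀ hρ₀ (Or.inr ⟨hyim, hsub⟩) hxball
        exact ⟨C, hC, fun ρ' h1 h2 => (hb ρ' h1 h2).mono fun _ h => h.1⟩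

end Frame

/-- **Registered statement `engineBoundaryData`** = the skeleton's `stub_engineBoundaryData :
DevelopingMapExact → RootWedgeBound → FlatMassLaws → LocalSupBound → EngineBoundaryData` with the
line-local definitions unfolded verbatim (crux stmt-CriticalPhenomena-14004, line `pick-half-plane`):
every engine limit satisfies the hypotheses (I1)–(I4) of `pickEngine_stage2`.
[cite: DuminilCopinSmirnov2012, §4 (the map H with dH = F dz)] -/
theorem engineBoundaryData :
    ((∀ (Λ : Finset HexVertex), hexDomainSimplyConnected Λ → ∀ a ∈ hexDomainBoundary Λ, ∃ H : Site 2
    → ℂ, IsPotential Λ a H) ∧ (∀ (Λ : Finset HexVertex), hexDomainSimplyConnected Λ → ∀ (u w :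
    HexVertex), hexGraph.Adj u w → u ∉ Λ → w ∈ Λ → ∀ (u' w' : HexVertex), hexGraph.Adj u' w' → u' ∉
    Λ → w' ∈ Λ → s(u', w') ≠ s(u, w) → ∀ γ : HexMidEdgeSAW Λ s(u, w) s(u', w'), (hexMidpoint s(u',
    w') - hexCenter w') * hexParafermionicObservable Λ s(u, w) hexCriticalFugacity (5 / 8) s(u', w')
    = (hexCenter w - hexCenter u) / 2 * Complex.exp (Complex.I * (3 / 8 : ℂ) * (γ.winding : ℂ)) *
    (‖hexParafermionicObservable Λ s(u, w) hexCriticalFugacity 0 s(u', w')‖ : ℂ)) ∧ (∀ (Λ : Finset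
    HexVertex), hexDomainSimplyConnected Λ → ∀ (u w : HexVertex), hexGraph.Adj u w → u ∉ Λ → w ∈ Λ →
    ∀ (m k₁ k₂ : ℤ), IsFlatFloor Λ m k₁ k₂ → (∀ k : ℤ, k₁ ≤ k → k ≤ k₂ → floorEdge k m ≠ s(u, w)) →
    ∀ (kb ke : ℤ), k₁ ≤ kb → kb ≤ k₂ → k₁ ≤ ke → ke ≤ k₂ → ∀ (γb : HexMidEdgeSAW Λ s(u, w)
    (floorEdge kb m)) (γe : HexMidEdgeSAW Λ s(u, w) (floorEdge ke m)), γe.winding = γb.winding) ∧ (∀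
    (Λ : Finset HexVertex), hexDomainSimplyConnected Λ → ∀ (m k₁ k₂ ka : ℤ), IsFlatFloor Λ m k₁ k₂ →
    k₁ ≤ ka → ka ≤ k₂ → ∀ (ke : ℤ), k₁ ≤ ke → ke ≤ k₂ → ∀ γ : HexMidEdgeSAW Λ (floorEdge ka m)
    (floorEdge ke m), (ka < ke → γ.winding = -Real.pi) ∧ (ke < ka → γ.winding = Real.pi))) → (∀ (D :
    DobrushinDomain) (ρ : ℝ) (Λ : ℝ → Finset HexVertex) (m : ℝ → ℤ) (b : ℝ → Sym2 HexVertex), (0 < ρ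
    ∧ D.carrier ∩ Metric.ball (D.pt 1) ρ = {z : ℂ | (D.pt 1).im < z.im} ∩ Metric.ball (D.pt 1) ρ ∧
    (∀ᶠ δ : ℝ in 𝓝[>] 0, hexDomainSimplyConnected (Λ δ) ∧ b δ ∈ hexDomainBoundary (Λ δ) ∧
    (hexGraph.induce ((Λ δ : Finset HexVertex) : Set HexVertex)).Preconnected ∧ (∀ v ∈ Λ δ, (δ : ℂ)
    * hexCenter v ∈ D.carrier) ∧ (∀ v : HexVertex, (δ : ℂ) * hexCenter v ∈ Metric.ball (D.pt 1) ρ →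
    (v ∈ Λ δ ↔ m δ ≤ v.1 1))) ∧ (∀ K : Set ℂ, IsCompact K → K ⊆ D.carrier → ∀ᶠ δ : ℝ in 𝓝[>] 0, ∀ v
    : HexVertex, (δ : ℂ) * hexCenter v ∈ K → v ∈ Λ δ) ∧ Tendsto (fun δ : ℝ => (δ : ℂ) * hexMidpoint
    (b δ)) (𝓝[>] 0) (𝓝 (D.pt 1))) → ∀ (x : ℂ) (e : ℝ → Sym2 HexVertex) (r : ℝ) (mr : ℝ → ℤ), (0 < r
    ∧ D.carrier ∩ Metric.ball x r = {z : ℂ | x.im < z.im} ∩ Metric.ball x r ∧ (∀ᶠ δ : ℝ in 𝓝[>] 0, e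
    δ ∈ hexDomainBoundary (Λ δ) ∧ Nonempty (HexMidEdgeSAW (Λ δ) (e δ) (b δ)) ∧ (∀ v : HexVertex, (δ
    : ℂ) * hexCenter v ∈ Metric.ball x r → (v ∈ Λ δ ↔ mr δ ≤ v.1 1))) ∧ Tendsto (fun δ : ℝ => (δ :
    ℂ) * hexMidpoint (e δ)) (𝓝[>] 0) (𝓝 x)) → x ≠ D.pt 1 → ∃ M : ℝ, ∀ᶠ δ : ℝ in 𝓝[>] 0, ∀ H : Site 2
    → ℂ, IsPotential (Λ δ) (e δ) H → ∀ (ub wb : HexVertex), b δ = s(ub, wb) → ∀ sb : Site 2, sb ∈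
    hexFaceVertices ub → sb ∈ hexFaceVertices wb → ∀ v ∈ Λ δ, ∀ s ∈ hexFaceVertices v, (δ : ℂ) *
    triEmbed s ∈ Metric.closedBall x (r / 2) → δ * ((H s).re - (H sb).re) ≤ M *
    ‖hexParafermionicObservable (Λ δ) (e δ) hexCriticalFugacity 0 (b δ)‖) → (∀ (D : DobrushinDomain)
    (ρ : ℝ) (Λ : ℝ → Finset HexVertex) (m : ℝ → ℤ) (b : ℝ → Sym2 HexVertex), (0 < ρ ∧ D.carrier ∩
    Metric.ball (D.pt 1) ρ = {z : ℂ | (D.pt 1).im < z.im} ∩ Metric.ball (D.pt 1) ρ ∧ (∀ᶠ δ : ℝ in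
    𝓝[>] 0, hexDomainSimplyConnected (Λ δ) ∧ b δ ∈ hexDomainBoundary (Λ δ) ∧ (hexGraph.induce ((Λ δ
    : Finset HexVertex) : Set HexVertex)).Preconnected ∧ (∀ v ∈ Λ δ, (δ : ℂ) * hexCenter v ∈
    D.carrier) ∧ (∀ v : HexVertex, (δ : ℂ) * hexCenter v ∈ Metric.ball (D.pt 1) ρ → (v ∈ Λ δ ↔ m δ ≤
    v.1 1))) ∧ (∀ K : Set ℂ, IsCompact K → K ⊆ D.carrier → ∀ᶠ δ : ℝ in 𝓝[>] 0, ∀ v : HexVertex, (δ :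
    ℂ) * hexCenter v ∈ K → v ∈ Λ δ) ∧ Tendsto (fun δ : ℝ => (δ : ℂ) * hexMidpoint (b δ)) (𝓝[>] 0) (𝓝
    (D.pt 1))) → ∀ (x : ℂ) (e : ℝ → Sym2 HexVertex) (r : ℝ) (mr : ℝ → ℤ), (0 < r ∧ D.carrier ∩
    Metric.ball x r = {z : ℂ | x.im < z.im} ∩ Metric.ball x r ∧ (∀ᶠ δ : ℝ in 𝓝[>] 0, e δ ∈
    hexDomainBoundary (Λ δ) ∧ Nonempty (HexMidEdgeSAW (Λ δ) (e δ) (b δ)) ∧ (∀ v : HexVertex, (δ : ℂ)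
    * hexCenter v ∈ Metric.ball x r → (v ∈ Λ δ ↔ mr δ ≤ v.1 1))) ∧ Tendsto (fun δ : ℝ => (δ : ℂ) *
    hexMidpoint (e δ)) (𝓝[>] 0) (𝓝 x)) → x ≠ D.pt 1 →
    let Z : ℝ → Sym2 HexVertex → ℝ := fun δ z => ‖hexParafermionicObservable (Λ δ) (e δ) hexCriticalFugacity 0 z‖;
       (∀ (y : ℂ) (ρ₀ : ℝ), 0 < ρ₀ → (y.im = (D.pt 1).im ∧ Metric.closedBall y ρ₀ ⊆ Metric.ball
    (D.pt 1) ρ ∨ y.im = x.im ∧ Metric.closedBall y ρ₀ ⊆ Metric.ball x r) → x ∉ Metric.closedBall y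
    (2 * ρ₀) → ∃ C : ℝ, 0 < C ∧ ∀ ρ' : ℝ, 0 < ρ' → ρ' ≤ ρ₀ → ∀ᶠ δ : ℝ in 𝓝[>] 0, C⁻¹ * ρ' * Z δ (b
    δ) ≤ δ * ∑ᶠ e' ∈ {e' : Sym2 HexVertex | e' ∈ hexDomainBoundary (Λ δ) ∧ (δ : ℂ) * hexMidpoint e'
    ∈ Metric.ball y ρ'}, Z δ e' ∧ δ * ∑ᶠ e' ∈ {e' : Sym2 HexVertex | e' ∈ hexDomainBoundary (Λ δ) ∧
    (δ : ℂ) * hexMidpoint e' ∈ Metric.ball y ρ'}, Z δ e' ≤ C * ρ' * Z δ (b δ)) ∧ (∀ A : ℝ, ∃ η : ℝ,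
    0 < η ∧ η < r / 2 ∧ ∀ᶠ δ : ℝ in 𝓝[>] 0, A * Z δ (b δ) ≤ δ * ∑ᶠ e' ∈ {e' : Sym2 HexVertex | e' ∈
    hexDomainBoundary (Λ δ) ∧ (δ : ℂ) * hexMidpoint e' ∈ Metric.ball x (r / 2) ∧ x.re + η < ((δ : ℂ)
    * hexMidpoint e').re}, Z δ e')) → (∀ (D : DobrushinDomain) (ρ : ℝ) (Λ : ℝ → Finset HexVertex) (m
    : ℝ → ℤ) (b : ℝ → Sym2 HexVertex), (0 < ρ ∧ D.carrier ∩ Metric.ball (D.pt 1) ρ = {z : ℂ | (D.pt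
    1).im < z.im} ∩ Metric.ball (D.pt 1) ρ ∧ (∀ᶠ δ : ℝ in 𝓝[>] 0, hexDomainSimplyConnected (Λ δ) ∧ b
    δ ∈ hexDomainBoundary (Λ δ) ∧ (hexGraph.induce ((Λ δ : Finset HexVertex) : Set
    HexVertex)).Preconnected ∧ (∀ v ∈ Λ δ, (δ : ℂ) * hexCenter v ∈ D.carrier) ∧ (∀ v : HexVertex, (δ
    : ℂ) * hexCenter v ∈ Metric.ball (D.pt 1) ρ → (v ∈ Λ δ ↔ m δ ≤ v.1 1))) ∧ (∀ K : Set ℂ,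
    IsCompact K → K ⊆ D.carrier → ∀ᶠ δ : ℝ in 𝓝[>] 0, ∀ v : HexVertex, (δ : ℂ) * hexCenter v ∈ K → v
    ∈ Λ δ) ∧ Tendsto (fun δ : ℝ => (δ : ℂ) * hexMidpoint (b δ)) (𝓝[>] 0) (𝓝 (D.pt 1))) → ∀ (x : ℂ)
    (e : ℝ → Sym2 HexVertex) (r : ℝ) (mr : ℝ → ℤ), (0 < r ∧ D.carrier ∩ Metric.ball x r = {z : ℂ |
    x.im < z.im} ∩ Metric.ball x r ∧ (∀ᶠ δ : ℝ in 𝓝[>] 0, e δ ∈ hexDomainBoundary (Λ δ) ∧ Nonempty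
    (HexMidEdgeSAW (Λ δ) (e δ) (b δ)) ∧ (∀ v : HexVertex, (δ : ℂ) * hexCenter v ∈ Metric.ball x r →
    (v ∈ Λ δ ↔ mr δ ≤ v.1 1))) ∧ Tendsto (fun δ : ℝ => (δ : ℂ) * hexMidpoint (e δ)) (𝓝[>] 0) (𝓝 x))
    → x ≠ D.pt 1 → ∀ K : Set ℂ, IsCompact K → K ⊆ D.carrier ∪ (({z : ℂ | z.im = (D.pt 1).im} ∩
    Metric.ball (D.pt 1) ρ) ∪ ({z : ℂ | z.im = x.im} ∩ Metric.ball x r)) → x ∉ K → ∃ C : ℝ, ∀ᶠ δ : ℝ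
    in 𝓝[>] 0, ∀ z ∈ hexDomainMidEdges (Λ δ), (δ : ℂ) * hexMidpoint z ∈ K →
    ‖hexParafermionicObservable (Λ δ) (e δ) hexCriticalFugacity (5 / 8) z‖ ≤ C *
    ‖hexParafermionicObservable (Λ δ) (e δ) hexCriticalFugacity (5 / 8) (b δ)‖) → ∀ (D :
    DobrushinDomain) (ρ : ℝ) (Λ : ℝ → Finset HexVertex) (m : ℝ → ℤ) (b : ℝ → Sym2 HexVertex), (0 < ρ
    ∧ D.carrier ∩ Metric.ball (D.pt 1) ρ = {z : ℂ | (D.pt 1).im < z.im} ∩ Metric.ball (D.pt 1) ρ ∧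
    (∀ᶠ δ : ℝ in 𝓝[>] 0, hexDomainSimplyConnected (Λ δ) ∧ b δ ∈ hexDomainBoundary (Λ δ) ∧
    (hexGraph.induce ((Λ δ : Finset HexVertex) : Set HexVertex)).Preconnected ∧ (∀ v ∈ Λ δ, (δ : ℂ)
    * hexCenter v ∈ D.carrier) ∧ (∀ v : HexVertex, (δ : ℂ) * hexCenter v ∈ Metric.ball (D.pt 1) ρ →
    (v ∈ Λ δ ↔ m δ ≤ v.1 1))) ∧ (∀ K : Set ℂ, IsCompact K → K ⊆ D.carrier → ∀ᶠ δ : ℝ in 𝓝[>] 0, ∀ v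
    : HexVertex, (δ : ℂ) * hexCenter v ∈ K → v ∈ Λ δ) ∧ Tendsto (fun δ : ℝ => (δ : ℂ) * hexMidpoint
    (b δ)) (𝓝[>] 0) (𝓝 (D.pt 1))) → ∀ (x : ℂ) (e : ℝ → Sym2 HexVertex) (r : ℝ) (mr : ℝ → ℤ), (0 < r
    ∧ D.carrier ∩ Metric.ball x r = {z : ℂ | x.im < z.im} ∩ Metric.ball x r ∧ (∀ᶠ δ : ℝ in 𝓝[>] 0, e
    δ ∈ hexDomainBoundary (Λ δ) ∧ Nonempty (HexMidEdgeSAW (Λ δ) (e δ) (b δ)) ∧ (∀ v : HexVertex, (δ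
    : ℂ) * hexCenter v ∈ Metric.ball x r → (v ∈ Λ δ ↔ mr δ ≤ v.1 1))) ∧ Tendsto (fun δ : ℝ => (δ :
    ℂ) * hexMidpoint (e δ)) (𝓝[>] 0) (𝓝 x)) → x ≠ D.pt 1 → ∀ ns : ℕ → ℝ, Tendsto ns atTop (𝓝[>] 0) →
    ∀ (h g : ℂ → ℂ) (α : ℂ), (α ≠ 0 ∧ DifferentiableOn ℂ g D.carrier ∧ DifferentiableOn ℂ h
    D.carrier ∧ (∀ z ∈ D.carrier, deriv h z = α * g z) ∧ (∀ ψ : ℂ → ℂ, (Continuous ψ ∧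
    HasCompactSupport ψ ∧ tsupport ψ ⊆ D.carrier) → Tendsto (fun n => (((ns n : ℝ) : ℂ) ^ 2 * (∑ᶠ z
    ∈ hexDomainMidEdges (Λ (ns n)), ψ (((ns n : ℝ) : ℂ) * hexMidpoint z) *
    hexParafermionicObservable (Λ (ns n)) (e (ns n)) hexCriticalFugacity (5 / 8) z) /
    hexParafermionicObservable (Λ (ns n)) (e (ns n)) hexCriticalFugacity (5 / 8) (b (ns n)))) atTop
    (𝓝 (∫ z, ψ z * g z))) ∧ (ContinuousOn h ((D.carrier ∪ (({z : ℂ | z.im = (D.pt 1).im} ∩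
    Metric.ball (D.pt 1) ρ) ∪ ({z : ℂ | z.im = x.im} ∩ Metric.ball x r))) \ {x}) ∧ (∀ K : Set ℂ,
    IsCompact K → K ⊆ (D.carrier ∪ (({z : ℂ | z.im = (D.pt 1).im} ∩ Metric.ball (D.pt 1) ρ) ∪ ({z :
    ℂ | z.im = x.im} ∩ Metric.ball x r))) \ {x} → ∀ ε : ℝ, 0 < ε → ∀ᶠ n : ℕ in atTop, ∀ H : Site 2 →
    ℂ, IsPotential (Λ (ns n)) (e (ns n)) H → ∀ (ub wb : HexVertex), b (ns n) = s(ub, wb) → ∀ sb :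
    Site 2, sb ∈ hexFaceVertices ub → sb ∈ hexFaceVertices wb → ∀ s : Site 2, IsLatticeSite (Λ (ns
    n)) s → ((ns n : ℝ) : ℂ) * triEmbed s ∈ K → ‖((ns n : ℝ) : ℂ) * (H s - H sb) /
    hexParafermionicObservable (Λ (ns n)) (e (ns n)) hexCriticalFugacity (5 / 8) (b (ns n)) - h
    (((ns n : ℝ) : ℂ) * triEmbed s)‖ < ε))) → ∃ (r₀ : ℝ) (p ω : ℂ) (θ M : ℝ), 0 < r₀ ∧ r₀ ≤ r ∧
    ContinuousOn h (({z : ℂ | x.im ≤ z.im} ∩ Metric.ball x r₀) \ {x}) ∧ (∀ z ∈ Metric.ball x r₀,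
    z.im = x.im → x.re < z.re → ∃ s : ℝ, h z = p + Complex.exp ((θ : ℂ) * Complex.I) * s) ∧ (∀ z ∈
    Metric.ball x r₀, z.im = x.im → z.re < x.re → ∃ s : ℝ, h z = p + Complex.exp (((θ - Real.pi / 4
    : ℝ) : ℂ) * Complex.I) * s) ∧ ‖ω‖ = 1 ∧ 0 < (ω * Complex.exp (-((θ : ℂ) * Complex.I))).re ∧ (ω *
    Complex.exp (-((θ : ℂ) * Complex.I))).im < (ω * Complex.exp (-((θ : ℂ) * Complex.I))).re ∧ (∀ z
    ∈ ({z : ℂ | x.im ≤ z.im} ∩ Metric.ball x r₀) \ {x}, -M ≤ ((starRingEnd ℂ) ω * h z).re) ∧ (∀ A :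
    ℝ, ∃ᶠ z in 𝓝[D.carrier] x, A ≤ ‖h z‖) ∧ (∀ y ∈ ({z : ℂ | z.im = (D.pt 1).im} ∩ Metric.ball (D.pt
    1) ρ) ∪ ({z : ℂ | z.im = x.im} ∩ Metric.ball x r), y ≠ x → ∃ ρ' : ℝ, 0 < ρ' ∧ ∃ θ' : ℝ, ∃ p' :
    ℂ, ∃ c' : ℝ, 0 < c' ∧ ContinuousOn h ({z : ℂ | y.im ≤ z.im} ∩ Metric.ball y ρ') ∧ (∀ z ∈
    Metric.ball y ρ', z.im = y.im → (Complex.exp (-((θ' : ℂ) * Complex.I)) * (h z - p')).im = 0) ∧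
    (∀ t : ℝ, 0 < t → t < ρ' → c' * t ≤ |(Complex.exp (-((θ' : ℂ) * Complex.I)) * (h (y + (t : ℂ) *
    Complex.I) - p')).im|)) := by
  intro _ hW hF hS D ρ Λ m b hAF x e r mr hPR hx ns hns h g α hEL
  obtain ⟨-, -, hhol, -, -, hcont, hconv⟩ := hEL
  obtain ⟨hFa, hFb⟩ := hF D ρ Λ m b hAF x e r mr hPR hx
  exact engineBoundaryData_core hAF hPR hx (hS D ρ Λ m b hAF x e r mr hPR hx) hns hcont hconv hhol
    (hW D ρ Λ m b hAF x e r mr hPR hx) hFa hFb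

end Summit.CriticalPhenomena.SAWScalingLimit.Theorems.PickHalfPlane.BoundaryDataTransfer

end
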